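import Summits.CriticalPhenomena.CardyFormulaZ2.Theorems.CardyComplexConeParafermionToSLESixFamiliesDiamondClosedPrecompactnessFreeSegment
import HarnessLib

/-!
# Every marked diamond has a WIRED boundary segment (line `potential-darboux-picard-diamond`, S3 (c), part 6)

Crux `ParafermionToSLESixFamilies` (stmt-CriticalPhenomena-11389), line `potential-darboux-picard-diamond`, conditional
helper `freeTouchLower_of_diagArmLower` of S3. The gluing of the touch probability of a free side to the WIRED arc needs a
straight piece of the wired arc `D.arc 0` (its discrete bulk consists of `A`-sites, `eventually_arcs_near_wiredSegment`);
this file is the wired twin of the landed `exists_isBdrySegment_subset_arc_one_of_isMarkedDiamond`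
(`…DiamondClosedPrecompactnessFreeSegment.lean`, whose elementary lemmas are reused): the wired arc is the image of the
parameter window `[mark 0, mark 1] ⊆ [0, 1)`, on which the boundary loop is injective, so a straight sub-window yields an
oriented boundary segment contained in `D.arc 0` (`exists_isBdrySegment_of_straightWiredWindow`), and a compact
sub-window of a marked diamond runs inside one of the four side lines (`exists_isBdrySegment_subset_arc_zero_of_isMarkedDiamond`).
-/

noncomputable section

namespace Summit.CriticalPhenomena.CardyFormulaZ2.Cruxes.ParafermionToSLESixFamilies.PotentialDarbouxPicardDiamond

open scoped Topology
open Filter Set Metric Complex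
open Literature.Probability.RandomPlanarGeometry

/-- The wired arc `D.arc 0 = (ab)` is the image of the parameter window `[mark 0, mark 1]`. -/
theorem arc_zero_eq_image_Icc (D : DobrushinDomain) : D.arc 0 = D.boundary '' Icc (D.mark 0) (D.mark 1) := by
  rw [MarkedDomain.arc, MarkedDomain.nextMark_zero_two]

/-- The boundary loop is injective on the wired-arc parameter window `[mark 0, mark 1] ⊆ [0, 1)`. -/
theorem boundary_injOn_wiredArcWindow (D : DobrushinDomain) : InjOn D.boundary (Icc (D.mark 0) (D.mark 1)) :=
  D.injOn_boundary.mono (Icc_subset_Ico_right (D.mark_mem 1).2 |>.trans (Ico_subset_Ico_left (D.mark_mem 0).1))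

/-- **A straight wired parameter window yields an oriented wired boundary segment.** Let the Dobrushin domain `D` lie
strictly on one side of the line `{Re((z - c)·μ) = κ}` (`μ ≠ 0`), and let the boundary loop run inside that line on a
non-degenerate parameter window `[s, t]` strictly inside the wired-arc window `(mark 0, mark 1)`. Then the straight segment
between `boundary s` and `boundary t`, suitably oriented, is an oriented boundary segment of `D` contained in `D.arc 0`. -/
theorem exists_isBdrySegment_of_straightWiredWindow (D : DobrushinDomain) {μ c : ℂ} (hμ : μ ≠ 0) {κ : ℝ}
    (hcar : ∀ z ∈ D.carrier, ((z - c) * μ).re < κ) {s t : ℝ} (hst : s < t) (hs : D.mark 0 < s)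
    (ht : t < D.mark 1) (hline : ∀ r ∈ Icc s t, ((D.boundary r - c) * μ).re = κ) :
    ∃ p q : ℂ, IsBdrySegment D p q ∧ segment ℝ p q ⊆ D.arc 0 := by
  have hinj := boundary_injOn_wiredArcWindow D
  have hIJ : Icc s t ⊆ Icc (D.mark 0) (D.mark 1) := Icc_subset_Icc hs.le ht.le
  have hsJ : s ∈ Icc (D.mark 0) (D.mark 1) := hIJ (left_mem_Icc.2 hst.le)
  have htJ : t ∈ Icc (D.mark 0) (D.mark 1) := hIJ (right_mem_Icc.2 hst.le)
  have hne : D.boundary s ≠ D.boundary t := fun h => hst.ne (hinj hsJ htJ h)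
  have hseg : segment ℝ (D.boundary s) (D.boundary t) ⊆ D.boundary '' Icc s t :=
    segment_subset_image_of_line hst.le D.continuous_boundary.continuousOn hμ hline
  have harc : segment ℝ (D.boundary s) (D.boundary t) ⊆ D.arc 0 := by
    rw [arc_zero_eq_image_Icc]
    exact hseg.trans (image_mono hIJ)
  have hfront : segment ℝ (D.boundary s) (D.boundary t) ⊆ frontier D.carrier := fun y hy => by
    obtain ⟨r, -, rfl⟩ := hseg hy
    exact D.boundary_mem_frontier r
  have hmark : ∀ m ∈ Icc (D.mark 0) (D.mark 1), m ∉ Icc s t →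
      D.boundary m ∉ segment ℝ (D.boundary s) (D.boundary t) := by
    intro m hm hmst hmem
    obtain ⟨r, hr, hrm⟩ := hseg hmem
    exact hmst (hinj (hIJ hr) hm hrm ▸ hr)
  have hmark_le : D.mark 0 ≤ D.mark 1 := hsJ.1.trans hsJ.2
  have hpt0 : D.pt 0 ∉ segment ℝ (D.boundary s) (D.boundary t) :=
    hmark (D.mark 0) ⟨le_rfl, hmark_le⟩ fun h => (not_le.2 hs) h.1
  have hpt1 : D.pt 1 ∉ segment ℝ (D.boundary s) (D.boundary t) :=
    hmark (D.mark 1) ⟨hmark_le, le_rfl⟩ fun h => (not_le.2 ht) h.2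
  -- the direction of the window inside the line
  set w : ℂ := D.boundary t - D.boundary s with hw
  have hwre : (w * μ).re = 0 := by
    have e : w * μ = (D.boundary t - c) * μ - (D.boundary s - c) * μ := by rw [hw]; ring
    rw [e, Complex.sub_re, hline s (left_mem_Icc.2 hst.le), hline t (right_mem_Icc.2 hst.le), sub_self]
  set m : ℝ := (w * μ).im with hm
  have hwμ : w * μ = I * m := Complex.ext (by simp [hwre]) (by simp [hm])
  have hm0 : m ≠ 0 := by
    intro h0
    have h : w * μ = 0 := by rw [hwμ, h0]; simp
    rcases mul_eq_zero.1 h with h | h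
    · exact hne (sub_eq_zero.1 h).symm
    · exact hμ h
  have orient : ∀ p q : ℂ, ((p - c) * μ).re = κ → ∀ m' : ℝ, 0 < m' → (q - p) * μ = I * m' →
      ∀ z ∈ D.carrier, 0 < ((z - p) * (starRingEnd ℂ) (q - p)).im := by
    intro p q hp m' hm' hpq z hz
    have key := im_mul_conj_mul_normSq_eq hpq z
    have hneg : ((z - p) * μ).re < 0 := by
      have e : (z - p) * μ = (z - c) * μ - (p - c) * μ := by ring
      rw [e, Complex.sub_re, hp]
      linarith [hcar z hz]
    have hpos : 0 < ((z - p) * (starRingEnd ℂ) (q - p)).im * Complex.normSq μ := by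
      rw [key]; nlinarith
    exact pos_of_mul_pos_left hpos (Complex.normSq_nonneg μ)
  rcases lt_or_gt_of_ne hm0 with hneg | hpos
  · refine ⟨D.boundary t, D.boundary s, ⟨hne.symm, ?_, ?_, ?_, ?_⟩, ?_⟩
    · rw [segment_symm]; exact hfront
    · rw [openSegment_symm]; exact fun h => hpt0 (openSegment_subset_segment ℝ _ _ h)
    · rw [openSegment_symm]; exact fun h => hpt1 (openSegment_subset_segment ℝ _ _ h)
    · refine orient _ _ (hline t (right_mem_Icc.2 hst.le)) (-m) (by linarith) ?_
      rw [show D.boundary s - D.boundary t = -w by rw [hw]; ring, neg_mul, hwμ]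
      push_cast
      ring
    · rw [segment_symm]; exact harc
  · refine ⟨D.boundary s, D.boundary t, ⟨hne, hfront, ?_, ?_, ?_⟩, harc⟩
    · exact fun h => hpt0 (openSegment_subset_segment ℝ _ _ h)
    · exact fun h => hpt1 (openSegment_subset_segment ℝ _ _ h)
    · exact orient _ _ (hline s (left_mem_Icc.2 hst.le)) m hpos hwμ

/-- **Every marked diamond has a wired boundary segment**: for `D` a marked diamond there are `p ≠ q` with
`IsBdrySegment D p q` and `segment ℝ p q ⊆ D.arc 0`. -/
theorem exists_isBdrySegment_subset_arc_zero_of_isMarkedDiamond : ∀ (D : DobrushinDomain), IsMarkedDiamond D → ∃ p q : ℂ, IsBdrySegment D p q ∧ segment ℝ p q ⊆ D.arc 0 := by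
  intro D hD
  obtain ⟨c, α, β, hα, hβ, hcar⟩ := hD
  have mem : ∀ z : ℂ, z ∈ D.carrier ↔
      |((z - c) * exp (-(Real.pi / 4 : ℝ) * I)).re| < α ∧ |((z - c) * exp (-(Real.pi / 4 : ℝ) * I)).im| < β :=
    fun z => Set.ext_iff.1 hcar z
  set E : ℂ := exp (-(Real.pi / 4 : ℝ) * I) with hE
  have hE0 : E ≠ 0 := Complex.exp_ne_zero _
  have hclos : closure D.carrier ⊆ {z | |((z - c) * E).re| ≤ α ∧ |((z - c) * E).im| ≤ β} := by
    refine closure_minimal (fun z hz => ?_) ?_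
    · obtain ⟨h1, h2⟩ := (mem z).1 hz
      exact ⟨h1.le, h2.le⟩
    · have hc : Continuous fun z : ℂ => (z - c) * E := (continuous_id.sub continuous_const).mul continuous_const
      exact (isClosed_le (continuous_abs.comp (Complex.continuous_re.comp hc)) continuous_const).inter
        (isClosed_le (continuous_abs.comp (Complex.continuous_im.comp hc)) continuous_const)
  have hfr : ∀ z ∈ frontier D.carrier, ((z - c) * E).re = α ∨ ((z - c) * E).re = -α ∨
      ((z - c) * E).im = β ∨ ((z - c) * E).im = -β := by
    intro z hz
    obtain ⟨h1a, h1b⟩ := hclos (frontier_subset_closure hz)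
    have h2 : z ∉ D.carrier := fun h => by
      have : z ∈ D.carrier ∩ frontier D.carrier := ⟨h, hz⟩
      rw [D.isOpen.inter_frontier_eq] at this
      exact this
    by_contra hcon
    push Not at hcon
    refine h2 ((mem z).2 ⟨lt_of_le_of_ne h1a fun habs => ?_, lt_of_le_of_ne h1b fun habs => ?_⟩)
    · rcases (abs_eq hα.le).1 habs with h | h
      exacts [hcon.1 h, hcon.2.1 h]
    · rcases (abs_eq hβ.le).1 habs with h | h
      exacts [hcon.2.2.1 h, hcon.2.2.2 h]
  have hcont : Continuous fun r : ℝ => (D.boundary r - c) * E :=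
    (D.continuous_boundary.sub continuous_const).mul continuous_const
  have hC₁ : IsClosed {r : ℝ | ((D.boundary r - c) * E).re = α} :=
    isClosed_eq (Complex.continuous_re.comp hcont) continuous_const
  have hC₂ : IsClosed {r : ℝ | ((D.boundary r - c) * E).re = -α} :=
    isClosed_eq (Complex.continuous_re.comp hcont) continuous_const
  have hC₃ : IsClosed {r : ℝ | ((D.boundary r - c) * E).im = β} :=
    isClosed_eq (Complex.continuous_im.comp hcont) continuous_const
  -- a compact window strictly inside the wired-arc parameter window
  have hlen : 0 < D.mark 1 - D.mark 0 := by linarith [D.mark_zero_lt_mark_one]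
  set s₀ : ℝ := D.mark 0 + (D.mark 1 - D.mark 0) / 3 with hs₀
  set t₀ : ℝ := D.mark 1 - (D.mark 1 - D.mark 0) / 3 with ht₀
  have hs₀' : D.mark 0 < s₀ := by rw [hs₀]; linarith
  have ht₀' : t₀ < D.mark 1 := by rw [ht₀]; linarith
  have hst₀ : s₀ < t₀ := by rw [hs₀, ht₀]; linarith
  have hcover : Icc s₀ t₀ ⊆ {r : ℝ | ((D.boundary r - c) * E).re = α} ∪
      ({r : ℝ | ((D.boundary r - c) * E).re = -α} ∪ ({r : ℝ | ((D.boundary r - c) * E).im = β} ∪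
        {r : ℝ | ((D.boundary r - c) * E).im = -β})) := fun r _ => by
    rcases hfr (D.boundary r) (D.boundary_mem_frontier r) with h | h | h | h
    exacts [Or.inl h, Or.inr (Or.inl h), Or.inr (Or.inr (Or.inl h)), Or.inr (Or.inr (Or.inr h))]
  have reNeg : ∀ z : ℂ, ((z - c) * -E).re = -((z - c) * E).re := fun z => by rw [mul_neg, Complex.neg_re]
  have reNegI : ∀ z : ℂ, ((z - c) * (E * -I)).re = ((z - c) * E).im := fun z => by
    rw [← mul_assoc]; simp
  have reI : ∀ z : ℂ, ((z - c) * (E * I)).re = -((z - c) * E).im := fun z => by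
    rw [← mul_assoc]; simp
  have car₁ : ∀ z ∈ D.carrier, ((z - c) * E).re < α := fun z hz => (abs_lt.1 ((mem z).1 hz).1).2
  have car₂ : ∀ z ∈ D.carrier, ((z - c) * -E).re < α := fun z hz => by
    rw [reNeg]; linarith [(abs_lt.1 ((mem z).1 hz).1).1]
  have car₃ : ∀ z ∈ D.carrier, ((z - c) * (E * -I)).re < β := fun z hz => by
    rw [reNegI]; exact (abs_lt.1 ((mem z).1 hz).2).2
  have car₄ : ∀ z ∈ D.carrier, ((z - c) * (E * I)).re < β := fun z hz => by
    rw [reI]; linarith [(abs_lt.1 ((mem z).1 hz).2).1]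
  have hI0 : E * -I ≠ 0 := mul_ne_zero hE0 (neg_ne_zero.2 I_ne_zero)
  have hI0' : E * I ≠ 0 := mul_ne_zero hE0 I_ne_zero
  have finish : ∀ {μ : ℂ}, μ ≠ 0 → ∀ {κ : ℝ}, (∀ z ∈ D.carrier, ((z - c) * μ).re < κ) →
      ∀ {a b : ℝ}, a < b → Icc a b ⊆ Icc s₀ t₀ → (∀ r ∈ Icc a b, ((D.boundary r - c) * μ).re = κ) →
      ∃ p q : ℂ, IsBdrySegment D p q ∧ segment ℝ p q ⊆ D.arc 0 := by
    intro μ hμ κ hκ a b hab hsub hl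
    have ha : D.mark 0 < a := hs₀'.trans_le (hsub (left_mem_Icc.2 hab.le)).1
    have hb : b < D.mark 1 := (hsub (right_mem_Icc.2 hab.le)).2.trans_lt ht₀'
    exact exists_isBdrySegment_of_straightWiredWindow D hμ hκ hab ha hb hl
  obtain ⟨a₁, b₁, hab₁, hsub₁, h₁ | h₁⟩ := exists_Icc_subset_of_subset_union hst₀ hC₁ hcover
  · exact finish hE0 car₁ hab₁ hsub₁ fun r hr => h₁ hr
  obtain ⟨a₂, b₂, hab₂, hsub₂, h₂ | h₂⟩ := exists_Icc_subset_of_subset_union hab₁ hC₂ h₁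
  · exact finish (neg_ne_zero.2 hE0) car₂ hab₂ (hsub₂.trans hsub₁) fun r hr => by
      rw [reNeg, show ((D.boundary r - c) * E).re = -α from h₂ hr, neg_neg]
  obtain ⟨a₃, b₃, hab₃, hsub₃, h₃ | h₃⟩ := exists_Icc_subset_of_subset_union hab₂ hC₃ h₂
  · exact finish hI0 car₃ hab₃ (hsub₃.trans (hsub₂.trans hsub₁)) fun r hr => by
      rw [reNegI]; exact h₃ hr
  · exact finish hI0' car₄ hab₃ (hsub₃.trans (hsub₂.trans hsub₁)) fun r hr => by
      rw [reI, show ((D.boundary r - c) * E).im = -β from h₃ hr, neg_neg]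

end Summit.CriticalPhenomena.CardyFormulaZ2.Cruxes.ParafermionToSLESixFamilies.PotentialDarbouxPicardDiamond

end
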